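import Mathlib
import HarnessLib
import Literature.Analysis.FluidPDE.NewtonPotential
import Summits.NavierStokesRegularity.NavierStokesRegularity.Theorems.PoloidalWindowDoorPoloidalWindowRigidityPressureRegime
import Summits.NavierStokesRegularity.NavierStokesRegularity.Theorems.PoloidalWindowDoorPoloidalWindowRigidityPressureOscillation
import Summits.NavierStokesRegularity.NavierStokesRegularity.Theorems.PoloidalWindowDoorPoloidalWindowRigiditySparseEnergyFarFlux

/-!
# Route `PoloidalWindowDoor`, crux `PoloidalWindowRigidity` (stmt-19708), ideator line `strain_tube` (ns-idea-8 g3) —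
# STUB S1 `stub_strainGrowth` PROVED: on a semi-elliptic slab the Riesz mass of the superharmonic slice pressure has LINEAR growth

Seat ns-poloidal-K2-p2 g10 (LEAD-lineage on 19708; file `--supports`).  Statement = `Cruxes/PoloidalWindowRigidity/Lines/strain_tube.lean`,
`stub_strainGrowth` (l. 151–171) VERBATIM; idea-crit-7 12:04:29Z price (P2): «land S1 as the bankable piece, consuming (F1) and the
PressureRegime identities BY NAME».  For a profile of the Type-I class, poloidal (`ω₂ ≡ 0`), with `I := ∂₂v₀∂₀v₂ + ∂₂v₁∂₁v₂ ≥ 0` on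
`ℝ³ × (a,b)`, `a < b ≤ 0`:  `∫_{B(x₀,R)} (|D_h v_h|²_F + (∂₂v₂)² + 2I)(s) ≤ K·R/(−s)` for every centre, every `R ≥ 1`, every `s ∈ (a,b)`.

Proof: `−Δp(s) = |D_h v_h|²_F + (∂₂v₂)² + 2I =: e ≥ 0` pointwise (`…PressureRegime.laplacian_pressure_eq_neg_sum` + `ω₂ = 0`; classical
pressure from `IsTypeIAncientMild.exists_isClassicalNSSolutionOn_Ioo`); against the tree cut-off `ψ = cutoff R (x₀ − ·)` (`= 1` on `B̄_R`,
`|Δψ| ≤ C_Δ/R²`, support `B̄_{2R}`): `∫_{B_R} e ≤ ∫ ψ e = ∫ ψ(−Δp) = −∫ (p − κ) Δψ` (Green's second identity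
`Literature…NewtonPotential.integral_mul_laplacian_comm`, `∫ Δψ = 0`) `≤ (C_Δ/R²) ∫_{B̄_{2R}} |p − κ| ≤ (C_Δ/R²) · K_osc C²/(−s) · |B̄_{2R}|`
by (F1) `…PressureOscillation.exists_integral_abs_sub_le_class` — linear in `R` (the scale-invariant floor for the strain).

WHAT THIS IS NOT: not a claim about Navier–Stokes regularity; it equips the semi-elliptic THICK cell `hST` with a floor-level datum and does
not close crux 19708 (bears_on LADDER-NS N0 via crux 19708, line strain_tube, stub S1). [folklore]
-/

noncomputable section

-- the summit and its single sub-problem share the name (CONVENTIONS §1), as in every Theorems file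
set_option linter.dupNamespace false

namespace Summit.NavierStokesRegularity.NavierStokesRegularity.Theorems.PoloidalWindowDoorPoloidalWindowRigidityStrainGrowth

open MeasureTheory Set Function Filter Topology Metric InnerProductSpace
open scoped RealInnerProductSpace Laplacian
open Literature.Analysis Literature.Analysis.FluidPDE
open Summit.NavierStokesRegularity.NavierStokesRegularity.Theorems.PoloidalWindowDoorPoloidalWindowRigidityWindow
open Summit.NavierStokesRegularity.NavierStokesRegularity.Theorems.PoloidalWindowDoorPoloidalWindowRigidityEquipartition
open Summit.NavierStokesRegularity.NavierStokesRegularity.Theorems.PoloidalWindowDoorPoloidalWindowRigidityPressureRegime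
open Summit.NavierStokesRegularity.NavierStokesRegularity.Theorems.PoloidalWindowDoorPoloidalWindowRigidityPressureOscillation
open Summit.NavierStokesRegularity.NavierStokesRegularity.Theorems.PoloidalWindowDoorPoloidalWindowRigiditySparseEnergyFarFlux

/-! ### The pointwise identity `−Δp = |D_h v_h|²_F + (∂₂v₂)² + 2I` on poloidal slices -/

/-- **`tr((Dv)²)` under `ω₂ = 0`.**  For a linear map `L` of `ℝ³` with `L(e₀)₁ = L(e₁)₀`:
`Σᵢ ⟪eᵢ, L(L eᵢ)⟫ = L(e₀)₀² + L(e₀)₁² + L(e₁)₀² + L(e₁)₁² + L(e₂)₂² + 2(L(e₂)₀L(e₀)₂ + L(e₂)₁L(e₁)₂)`. [folklore] -/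
theorem trace_sq_of_poloidal (L : EuclideanSpace ℝ (Fin 3) →L[ℝ] EuclideanSpace ℝ (Fin 3))
    (hω : L (EuclideanSpace.single 0 (1 : ℝ)) 1 = L (EuclideanSpace.single 1 (1 : ℝ)) 0) :
    ∑ i : Fin 3, ⟪(EuclideanSpace.single i (1 : ℝ) : EuclideanSpace ℝ (Fin 3)), L (L (EuclideanSpace.single i (1 : ℝ)))⟫ =
      L (EuclideanSpace.single 0 (1 : ℝ)) 0 ^ 2 + L (EuclideanSpace.single 0 (1 : ℝ)) 1 ^ 2 +
        L (EuclideanSpace.single 1 (1 : ℝ)) 0 ^ 2 + L (EuclideanSpace.single 1 (1 : ℝ)) 1 ^ 2 +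
        L (EuclideanSpace.single 2 (1 : ℝ)) 2 ^ 2 +
        2 * (L (EuclideanSpace.single 2 (1 : ℝ)) 0 * L (EuclideanSpace.single 0 (1 : ℝ)) 2 +
          L (EuclideanSpace.single 2 (1 : ℝ)) 1 * L (EuclideanSpace.single 1 (1 : ℝ)) 2) := by
  simp only [Fin.sum_univ_three, EuclideanSpace.inner_single_left, map_one, one_mul]
  rw [clm_apply_coord_eq_sum L (L (EuclideanSpace.single 0 (1 : ℝ))) 0,
    clm_apply_coord_eq_sum L (L (EuclideanSpace.single 1 (1 : ℝ))) 1,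
    clm_apply_coord_eq_sum L (L (EuclideanSpace.single 2 (1 : ℝ))) 2]
  simp only [Fin.sum_univ_three]
  rw [hω]
  ring

variable {S : Set ℝ} {ν : ℝ} {v : ℝ → EuclideanSpace ℝ (Fin 3) → EuclideanSpace ℝ (Fin 3)}
  {p : ℝ → EuclideanSpace ℝ (Fin 3) → ℝ}

/-- **PRESSURE ON A POLOIDAL SLICE.**  For a classical Navier–Stokes solution (zero force) at an interior time `s` and a point `x`
with `(curl v(s))(x)₂ = 0`:  `−Δp(s)(x) = |D_h v_h|²_F + (∂₂v₂)² + 2(∂₂v₀∂₀v₂ + ∂₂v₁∂₁v₂)` (coordinates `∂ᵢvⱼ = Dv(x)(eᵢ)ⱼ`). [folklore] -/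
theorem neg_laplacian_pressure_eq_strain (hcl : IsClassicalNSSolutionOn S ν 0 v p) {s : ℝ} (hs : s ∈ interior S)
    {x : EuclideanSpace ℝ (Fin 3)} (hpol : curl (v s) x 2 = 0) :
    -(Δ (p s)) x =
      fderiv ℝ (v s) x (EuclideanSpace.single 0 1) 0 ^ 2 + fderiv ℝ (v s) x (EuclideanSpace.single 0 1) 1 ^ 2 +
        fderiv ℝ (v s) x (EuclideanSpace.single 1 1) 0 ^ 2 + fderiv ℝ (v s) x (EuclideanSpace.single 1 1) 1 ^ 2 +
        fderiv ℝ (v s) x (EuclideanSpace.single 2 1) 2 ^ 2 +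
        2 * (fderiv ℝ (v s) x (EuclideanSpace.single 2 1) 0 * fderiv ℝ (v s) x (EuclideanSpace.single 0 1) 2 +
          fderiv ℝ (v s) x (EuclideanSpace.single 2 1) 1 * fderiv ℝ (v s) x (EuclideanSpace.single 1 1) 2) := by
  have hω : fderiv ℝ (v s) x (EuclideanSpace.single 0 1) 1 = fderiv ℝ (v s) x (EuclideanSpace.single 1 1) 0 := by
    rw [curl_apply_two] at hpol
    linarith
  rw [laplacian_pressure_eq_neg_sum hcl hs x, neg_neg, trace_sq_of_poloidal (fderiv ℝ (v s) x) hω]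

/-! ### Pairing the Laplacian with the ball cut-off -/

section Cutoff

variable {R : ℝ} {a : EuclideanSpace ℝ (Fin 3)} {ψ : EuclideanSpace ℝ (Fin 3) → ℝ}
  (hψ : ψ = fun x => cutoff R (a - x))
include hψ

/-- **Green against the cut-off, modulo constants**: for `q ∈ C²` and any constant `κ`,
`∫ ψ·(−Δq) = −∫ (q − κ)·Δψ` (`integral_mul_laplacian_comm`; the constant drops because `∫ Δψ = 0`). [folklore] -/
theorem integral_cutoff_mul_neg_laplacian (hR : 0 < R) {q : EuclideanSpace ℝ (Fin 3) → ℝ} (hq : ContDiff ℝ 2 q) (κ : ℝ) :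
    ∫ x, ψ x * (-(Δ q) x) = -∫ x, (q x - κ) * (Δ ψ) x := by
  have hψ2 : ContDiff ℝ 2 ψ := cutoffT_contDiff hψ
  have hψc : HasCompactSupport ψ := cutoffT_hasCompactSupport hψ hR
  have hqκ : ContDiff ℝ 2 (fun x => q x - κ) := hq.sub contDiff_const
  have hΔ : Δ (fun x => q x - κ) = Δ q := by
    funext x
    have h := hq.contDiffAt.laplacian_sub (contDiff_const (c := κ)).contDiffAt (x := x)
    rw [show (fun x => q x - κ) = q - fun _ => κ from rfl, h, laplacian_const]
    simp
  have h1 : ∫ x, ψ x * (Δ q) x = ∫ x, (Δ ψ) x * (q x - κ) := by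
    have h := integral_mul_laplacian_comm hqκ hψ2 hψc
    rw [hΔ] at h
    exact h
  calc ∫ x, ψ x * (-(Δ q) x) = -∫ x, ψ x * (Δ q) x := by
        rw [← integral_neg]
        exact integral_congr_ae (Eventually.of_forall fun x => by ring)
    _ = -∫ x, (q x - κ) * (Δ ψ) x := by
        rw [h1]
        congr 1
        exact integral_congr_ae (Eventually.of_forall fun x => by simp only [mul_comm])

/-- **The cut-off pairing is controlled by the mean oscillation**: `|∫ (q − κ)·Δψ| ≤ (C_Δ/R²)·∫_{B̄(a,2R)} |q − κ|`
(`|Δψ| ≤ C_Δ/R²`, `Δψ = 0` off `B̄(a,2R)`). [folklore] -/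
theorem abs_integral_sub_mul_laplacian_cutoff_le (hR : 0 < R) {Cl : ℝ}
    (hCl : ∀ R : ℝ, 0 < R → ∀ x : EuclideanSpace ℝ (Fin 3), |(Δ (cutoff R : EuclideanSpace ℝ (Fin 3) → ℝ)) x| ≤ Cl / R ^ 2)
    {q : EuclideanSpace ℝ (Fin 3) → ℝ} (hq : Continuous q) (κ : ℝ) :
    |∫ x, (q x - κ) * (Δ ψ) x| ≤ Cl / R ^ 2 * ∫ x in closedBall a (2 * R), |q x - κ| := by
  obtain ⟨Cg, -, hCg⟩ := exists_norm_fderiv_cutoff_le (E := EuclideanSpace ℝ (Fin 3))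
  have hψ2 : ContDiff ℝ 2 ψ := cutoffT_contDiff hψ
  have hΔc : Continuous (Δ ψ) := continuous_laplacian hψ2
  have hqc : Continuous fun x => q x - κ := hq.sub continuous_const
  -- pointwise domination by the indicator of the closed ball
  have hdom : ∀ x, |(q x - κ) * (Δ ψ) x| ≤ (closedBall a (2 * R)).indicator (fun x => Cl / R ^ 2 * |q x - κ|) x := by
    intro x
    by_cases hx : x ∈ closedBall a (2 * R)
    · rw [indicator_of_mem hx, abs_mul, mul_comm]
      exact mul_le_mul_of_nonneg_right ((cutoffT_bounds hψ hR hCl hCg x).1) (abs_nonneg _)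
    · rw [indicator_of_notMem hx]
      rw [mem_closedBall, not_le] at hx
      rw [(cutoffT_derivs_eq_zero hψ hR hx).1, mul_zero, abs_zero]
  have hint : IntegrableOn (fun x => Cl / R ^ 2 * |q x - κ|) (closedBall a (2 * R)) :=
    ((continuous_const.mul hqc.abs).continuousOn).integrableOn_compact (isCompact_closedBall a (2 * R))
  have hind : Integrable ((closedBall a (2 * R)).indicator fun x => Cl / R ^ 2 * |q x - κ|) :=
    (integrable_indicator_iff measurableSet_closedBall).2 hint
  calc |∫ x, (q x - κ) * (Δ ψ) x| ≤ ∫ x, |(q x - κ) * (Δ ψ) x| := by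
        rw [← Real.norm_eq_abs]; exact norm_integral_le_integral_norm _
    _ ≤ ∫ x, (closedBall a (2 * R)).indicator (fun x => Cl / R ^ 2 * |q x - κ|) x :=
        integral_mono_of_nonneg (Eventually.of_forall fun x => abs_nonneg _) hind (Eventually.of_forall hdom)
    _ = Cl / R ^ 2 * ∫ x in closedBall a (2 * R), |q x - κ| := by
        rw [integral_indicator measurableSet_closedBall, integral_const_mul]

/-- **The ball integral of a nonnegative continuous function is dominated by its cut-off integral.** [folklore] -/
theorem setIntegral_ball_le_integral_cutoff_mul (hR : 0 < R) {f : EuclideanSpace ℝ (Fin 3) → ℝ} (hf : Continuous f)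
    (hf0 : ∀ x, 0 ≤ f x) : ∫ x in ball a R, f x ≤ ∫ x, ψ x * f x := by
  have hψ0 : Continuous ψ := (cutoffT_contDiff hψ (n := 0)).continuous
  have hψc : HasCompactSupport ψ := cutoffT_hasCompactSupport hψ hR
  have hfi : Integrable fun x => ψ x * f x := (hψ0.mul hf).integrable_of_hasCompactSupport hψc.mul_right
  have hball : ∫ x in ball a R, f x = ∫ x in ball a R, ψ x * f x := by
    refine setIntegral_congr_fun measurableSet_ball fun x hx => ?_
    rw [cutoffT_eq_one hψ hR (le_of_lt (mem_ball.1 hx)), one_mul]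
  rw [hball]
  exact setIntegral_le_integral hfi (Eventually.of_forall fun x => mul_nonneg (cutoffT_nonneg_le_one hψ x).1 (hf0 x))

end Cutoff

/-! ### The linear growth of the semi-elliptic Riesz mass -/

/-- **STUB S1 (`stub_strainGrowth`) — THE LEVER of line `strain_tube`: on a SEMI-ELLIPTIC slab the Riesz mass of the superharmonic slice
pressure has LINEAR growth**, statement VERBATIM from `Cruxes/PoloidalWindowRigidity/Lines/strain_tube.lean` (l. 151–171).  For a profile
of the route's Type-I class (Type-I time decay `C`, continuity, Oseen mildness, divergence-free slices), poloidal (`⟪curl v(s), e₂⟫ ≡ 0`),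
with `I = ∂₂v₀∂₀v₂ + ∂₂v₁∂₁v₂ ≥ 0` on `ℝ³ × (a,b)`, `a < b ≤ 0`: there is `K` with
`∫_{B(x₀,R)} (|D_h v_h|²_F + (∂₂v₂)² + 2I)(s) ≤ K·R/(−s)` for all `s ∈ (a,b)`, all centres `x₀`, all `R ≥ 1`.
Proof: `−Δp = e ≥ 0` (`neg_laplacian_pressure_eq_strain`), Green against the ball cut-off modulo constants, and the class mean-oscillation
bound (F1) `…PressureOscillation.exists_integral_abs_sub_le_class` on `B̄(x₀,2R)`. [folklore] -/
theorem stub_strainGrowth :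
    ∀ (C : ℝ) (v : ℝ → EuclideanSpace ℝ (Fin 3) → EuclideanSpace ℝ (Fin 3)),
      Literature.Analysis.FluidPDE.HasTypeITimeDecay C v →
      ContinuousOn (Function.uncurry v) (Set.Iio (0 : ℝ) ×ˢ Set.univ) →
      (∀ s t : ℝ, s < t → t < 0 → ∀ x, v t x =
        Literature.Analysis.UnboundedOperators.heatExtension (v s) (t - s) x -
          Literature.Analysis.FluidPDE.oseenDuhamel 1 s v v t x) →
      (∀ t < 0, Literature.Analysis.FluidPDE.VectorCalculus.IsDivFree (v t)) →
      (∀ s < 0, ∀ y, ⟪Literature.Analysis.FluidPDE.curl (v s) y, EuclideanSpace.single 2 1⟫_ℝ = 0) →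
      ∀ a b : ℝ, a < b → b ≤ 0 →
          (∀ s ∈ Set.Ioo a b, ∀ y : EuclideanSpace ℝ (Fin 3),
            0 ≤ fderiv ℝ (v s) y (EuclideanSpace.single 2 1) 0 * fderiv ℝ (v s) y (EuclideanSpace.single 0 1) 2 +
                fderiv ℝ (v s) y (EuclideanSpace.single 2 1) 1 * fderiv ℝ (v s) y (EuclideanSpace.single 1 1) 2) →
          ∃ K : ℝ, ∀ s ∈ Set.Ioo a b, ∀ (x₀ : EuclideanSpace ℝ (Fin 3)) (R : ℝ), 1 ≤ R →
            ∫ y in Metric.ball x₀ R,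
              ((fderiv ℝ (v s) y (EuclideanSpace.single 0 1) 0) ^ 2 + (fderiv ℝ (v s) y (EuclideanSpace.single 0 1) 1) ^ 2 +
                (fderiv ℝ (v s) y (EuclideanSpace.single 1 1) 0) ^ 2 + (fderiv ℝ (v s) y (EuclideanSpace.single 1 1) 1) ^ 2 +
                (fderiv ℝ (v s) y (EuclideanSpace.single 2 1) 2) ^ 2 +
                2 * (fderiv ℝ (v s) y (EuclideanSpace.single 2 1) 0 * fderiv ℝ (v s) y (EuclideanSpace.single 0 1) 2 +
                fderiv ℝ (v s) y (EuclideanSpace.single 2 1) 1 * fderiv ℝ (v s) y (EuclideanSpace.single 1 1) 2)) ≤ K * R / (-s) := by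
  intro C v hrate hcont hmild hdiv hpol a b hab hb0 hI
  have ha0 : a < 0 := lt_of_lt_of_le hab hb0
  -- the classical pressure of the window `(a, 0)`
  obtain ⟨q, hcl⟩ := (isTypeIAncientMild_of_class hrate hcont hmild hdiv).exists_isClassicalNSSolutionOn_Ioo ha0
  -- the universal constants: the class oscillation bound (F1) and the cut-off Laplacian bound
  obtain ⟨K, hK0, hF1⟩ := exists_integral_abs_sub_le_class
  obtain ⟨Cl, hCl0, hCl⟩ := exists_abs_laplacian_cutoff_le (E := EuclideanSpace ℝ (Fin 3))
  set V₁ : ℝ := (volume : Measure (EuclideanSpace ℝ (Fin 3))).real (ball 0 1) with hV₁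
  have hV₁0 : 0 ≤ V₁ := measureReal_nonneg
  refine ⟨8 * Cl * K * V₁ * C ^ 2, fun s hs x₀ R hR => ?_⟩
  have hR0 : 0 < R := by linarith
  have hs0 : s < 0 := lt_of_lt_of_le hs.2 hb0
  have hns : 0 < -s := neg_pos.2 hs0
  have hsI : s ∈ Ioo a 0 := ⟨hs.1, hs0⟩
  have hsint : s ∈ interior (Ioo a 0) := by rwa [isOpen_Ioo.interior_eq]
  -- the slice pressure and the strain density `e = −Δq(s)`
  have hq2 : ContDiff ℝ 2 (q s) := (hcl.contDiff_pressure hsI).of_le (by norm_cast)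
  have hqc : Continuous (q s) := hq2.continuous
  set e : EuclideanSpace ℝ (Fin 3) → ℝ := fun y =>
    (fderiv ℝ (v s) y (EuclideanSpace.single 0 1) 0) ^ 2 + (fderiv ℝ (v s) y (EuclideanSpace.single 0 1) 1) ^ 2 +
      (fderiv ℝ (v s) y (EuclideanSpace.single 1 1) 0) ^ 2 + (fderiv ℝ (v s) y (EuclideanSpace.single 1 1) 1) ^ 2 +
      (fderiv ℝ (v s) y (EuclideanSpace.single 2 1) 2) ^ 2 +
      2 * (fderiv ℝ (v s) y (EuclideanSpace.single 2 1) 0 * fderiv ℝ (v s) y (EuclideanSpace.single 0 1) 2 +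
        fderiv ℝ (v s) y (EuclideanSpace.single 2 1) 1 * fderiv ℝ (v s) y (EuclideanSpace.single 1 1) 2) with he
  have hpol2 : ∀ y, curl (v s) y 2 = 0 := fun y => by
    have h := hpol s hs0 y
    rwa [EuclideanSpace.inner_single_right, one_mul, conj_trivial] at h
  have heq : ∀ y, e y = -(Δ (q s)) y := fun y => by
    rw [neg_laplacian_pressure_eq_strain hcl hsint (hpol2 y)]
  have hfun : e = fun y => -(Δ (q s)) y := funext heq
  have he0 : ∀ y, 0 ≤ e y := fun y => by
    have h := hI s hs y
    rw [he]
    nlinarith [sq_nonneg (fderiv ℝ (v s) y (EuclideanSpace.single 0 1) 0), sq_nonneg (fderiv ℝ (v s) y (EuclideanSpace.single 0 1) 1),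
      sq_nonneg (fderiv ℝ (v s) y (EuclideanSpace.single 1 1) 0), sq_nonneg (fderiv ℝ (v s) y (EuclideanSpace.single 1 1) 1),
      sq_nonneg (fderiv ℝ (v s) y (EuclideanSpace.single 2 1) 2)]
  have hec : Continuous e := by
    rw [hfun]; exact (continuous_laplacian hq2).neg
  -- the cut-off at scale `R` around `x₀`
  set ψ : EuclideanSpace ℝ (Fin 3) → ℝ := fun x => cutoff R (x₀ - x) with hψ
  -- (F1) on the doubled ball
  obtain ⟨κ, hκ⟩ := hF1 hrate hmild ha0 hcl s hsI x₀ (2 * R) (by linarith)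
  have hvol : (volume : Measure (EuclideanSpace ℝ (Fin 3))).real (closedBall x₀ (2 * R)) = 8 * R ^ 3 * V₁ := by
    rw [Measure.addHaar_real_closedBall volume x₀ (by positivity), finrank_euclideanSpace_fin, hV₁]
    ring
  -- the chain
  have h1 : ∫ y in ball x₀ R, e y ≤ ∫ y, ψ y * e y := setIntegral_ball_le_integral_cutoff_mul hψ hR0 hec he0
  have h2 : ∫ y, ψ y * e y = -∫ y, (q s y - κ) * (Δ ψ) y := by
    rw [hfun]
    exact integral_cutoff_mul_neg_laplacian hψ hR0 hq2 κ
  have h3 : |∫ y, (q s y - κ) * (Δ ψ) y| ≤ Cl / R ^ 2 * ∫ y in closedBall x₀ (2 * R), |q s y - κ| :=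
    abs_integral_sub_mul_laplacian_cutoff_le hψ hR0 hCl hqc κ
  have h4 : Cl / R ^ 2 * ∫ y in closedBall x₀ (2 * R), |q s y - κ| ≤
      Cl / R ^ 2 * (K * (C ^ 2 / (-s)) * (8 * R ^ 3 * V₁)) := by
    rw [← hvol]
    exact mul_le_mul_of_nonneg_left hκ (by positivity)
  show ∫ y in ball x₀ R, e y ≤ 8 * Cl * K * V₁ * C ^ 2 * R / (-s)
  calc ∫ y in ball x₀ R, e y ≤ ∫ y, ψ y * e y := h1
    _ = -∫ y, (q s y - κ) * (Δ ψ) y := h2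
    _ ≤ |∫ y, (q s y - κ) * (Δ ψ) y| := neg_le_abs _
    _ ≤ Cl / R ^ 2 * (K * (C ^ 2 / (-s)) * (8 * R ^ 3 * V₁)) := h3.trans h4
    _ = 8 * Cl * K * V₁ * C ^ 2 * R / (-s) := by
        field_simp

end Summit.NavierStokesRegularity.NavierStokesRegularity.Theorems.PoloidalWindowDoorPoloidalWindowRigidityStrainGrowth

end
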